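import Mathlib
import Literature.AlgebraicGeometry.Motives.FrobeniusTraceProofs
import Literature.NumberTheory.GaloisRepresentations.CompactImageCharpolyIntegral

/-!
# Trace limits I — Newton's identities with `p`-adic loss (route `PhantomRMYoshida`, crux
# `ResiduallyYoshidaLifting` = stmt-Langlands-13639, line `endoscopic-crossing-euler`, Stub 4)

Helper file (`--supports stmt-Langlands-13639`) of the lead prover of the line
`endoscopic-crossing-euler` for its Stub 4 `stub_weightTwoClassicality` (weight-(2,2) classicality
at the Yoshida maximal ideal, Galois form).  The hypothesis of that stub is a PRO-AUTOMORPHY clause: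
for every `n` the trace of `ρ : Γ_ℚ → GL₄(ℚ̄_p)` is uniformly `p⁻ⁿ`-close on `Γ_ℚ` to the trace of an
automorphic-or-endoscopic representation `r'`.  Its intended proof starts with an ENDO-REMOVAL /
limit argument, whose elementary `p`-adic analysis is proved here, sorry-free, over tree vocabulary:

* `coeff_charpolyRev_succ_mul` — Newton's identities in coefficient form over ANY commutative ring,
  `(m+1) c_{m+1} = -∑_{a+b=m} c_a tr(A^{b+1})` for `c = det(1 - X·A)`, read off the tree's
  logarithmic-derivative identity `derivative_charpolyRev` (`FrobeniusTraceProofs`);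
* `charpolyRev_eq_of_trace_pow_eq`, `charpoly_eq_of_trace_pow_eq` — in characteristic `0` the power
  traces determine the characteristic polynomial; `charpoly_eq_of_trace_eq` — hence two matrix
  representations of a monoid with equal traces have equal characteristic polynomials everywhere;
* `norm_coeff_charpolyRev_sub_le`, `norm_coeff_charpoly_sub_le` — **Newton with `p`-adic loss**: in
  an ultrametric normed field of characteristic `0`, integral matrices whose power traces are
  uniformly `ε`-close have characteristic polynomials `‖n!‖⁻¹ · ε`-close, coefficientwise;
* `norm_trace_le_one`, `norm_charpoly_coeff_le_one`, `norm_charpoly_coeff_sub_le_of_trace` — for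
  continuous representations of a COMPACT group (e.g. `Γ_ℚ`) over `ℚ̄_p = PadicAlgCl p`: traces and
  characteristic polynomials are integral (tree `FramedRep.charpoly_coeff_mem_integer`), and
  `‖tr r' - tr r‖_∞ ≤ ε` on the group gives `‖det(X - r'(g)) - det(X - r(g))‖ ≤ ‖n!‖_p⁻¹ ε`
  coefficientwise at every `g` (`norm_factorial_four_eq_one`: no loss in rank `4` for `p ≠ 2, 3`).

So along the pro-automorphy hypothesis of Stub 4 the characteristic polynomials `det(X - r'_n(g))`
converge to `det(X - ρ(g))` uniformly in `g` (used with Brauer–Nesbitt and Taylor's pseudocharacter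
theorem in the endo-removal step; companion file `…TraceLimitEndo.lean`).

References: Newton's identities / Le Verrier (folklore; Macdonald, *Symmetric functions and Hall
polynomials*, I (2.11')); Serre, *Abelian ℓ-adic representations*, I §2.3 (integrality).
-/

noncomputable section

open Polynomial Finset
open scoped Matrix

namespace Summit.Langlands.Langlands.Cruxes.ResiduallyYoshidaLifting.EndoscopicCrossingEuler

set_option linter.dupNamespace false

/-! ### Newton's identities, coefficient form, over any commutative ring -/

section Newton

variable {R : Type*} [CommRing R] {ι : Type*} [Fintype ι] [DecidableEq ι]

/-- **Newton's identities (coefficient form).**  For a square matrix `A` over any commutative ring,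
with `c = det(1 - X·A) = ∑ cₘ Xᵐ` the reversed characteristic polynomial:
`(m + 1) · c_{m+1} = -∑_{a+b=m} c_a · tr(A^{b+1})` — the coefficient of `Xᵐ` in the logarithmic
derivative identity `c' = -c · ∑ₘ tr(A^{m+1}) Xᵐ` (tree `derivative_charpolyRev`). [folklore] -/
theorem coeff_charpolyRev_succ_mul (A : Matrix ι ι R) (m : ℕ) :
    A.charpolyRev.coeff (m + 1) * ((m : R) + 1) =
      -∑ x ∈ antidiagonal m, A.charpolyRev.coeff x.1 * (A ^ (x.2 + 1)).trace := by
  have h := congrArg (PowerSeries.coeff (R := R) m)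
    (Literature.AlgebraicGeometry.Motives.FrobeniusTrace.derivative_charpolyRev A)
  rw [PowerSeries.coeff_derivative, Polynomial.coeff_coe, map_neg, PowerSeries.coeff_mul] at h
  rw [h]
  refine congrArg _ (Finset.sum_congr rfl fun x _ => ?_)
  rw [Polynomial.coeff_coe, PowerSeries.coeff_mk]

/-- **Traces of powers determine the characteristic polynomial in characteristic zero** (reversed
form): over a domain of characteristic `0`, two square matrices of the same size with
`tr(A^{j+1}) = tr(B^{j+1})` for all `j` have the same `det(1 - X·A)` (induction on the coefficient
with Newton's identities; `c₀ = 1`). [folklore] -/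
theorem charpolyRev_eq_of_trace_pow_eq [IsDomain R] [CharZero R] {A B : Matrix ι ι R}
    (h : ∀ j : ℕ, (A ^ (j + 1)).trace = (B ^ (j + 1)).trace) : A.charpolyRev = B.charpolyRev := by
  refine Polynomial.ext fun m => ?_
  induction m using Nat.strong_induction_on with
  | _ m ih =>
    cases m with
    | zero => rw [Polynomial.coeff_zero_eq_eval_zero, Polynomial.coeff_zero_eq_eval_zero,
        Matrix.eval_charpolyRev, Matrix.eval_charpolyRev]
    | succ m =>
      have hm : ((m : R) + 1) ≠ 0 := by exact_mod_cast Nat.succ_ne_zero m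
      refine mul_right_cancel₀ hm ?_
      rw [coeff_charpolyRev_succ_mul, coeff_charpolyRev_succ_mul]
      refine congrArg _ (Finset.sum_congr rfl fun x hx => ?_)
      rw [ih x.1 (by have := mem_antidiagonal.mp hx; omega), h]

/-- **Traces of powers determine the characteristic polynomial in characteristic zero**: over a
domain of characteristic `0`, `tr(A^{j+1}) = tr(B^{j+1})` for all `j` implies
`det(X - A) = det(X - B)` (the characteristic polynomial is monic of degree the size, and its
reverse is `det(1 - X·A)`, Mathlib `Matrix.reverse_charpoly`). [folklore] -/
theorem charpoly_eq_of_trace_pow_eq [IsDomain R] [CharZero R] {A B : Matrix ι ι R}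
    (h : ∀ j : ℕ, (A ^ (j + 1)).trace = (B ^ (j + 1)).trace) : A.charpoly = B.charpoly := by
  refine Polynomial.ext fun k => ?_
  by_cases hk : k ≤ Fintype.card ι
  · have hA := Polynomial.coeff_reverse A.charpoly (Fintype.card ι - k)
    have hB := Polynomial.coeff_reverse B.charpoly (Fintype.card ι - k)
    rw [Matrix.reverse_charpoly, Matrix.charpoly_natDegree_eq_dim,
      Polynomial.revAt_le (Nat.sub_le _ _), Nat.sub_sub_self hk] at hA hB
    rw [← hA, ← hB, charpolyRev_eq_of_trace_pow_eq h]
  · rw [Polynomial.coeff_eq_zero_of_natDegree_lt (by rw [Matrix.charpoly_natDegree_eq_dim]; omega),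
      Polynomial.coeff_eq_zero_of_natDegree_lt (by rw [Matrix.charpoly_natDegree_eq_dim]; omega)]

/-- **Equal traces give equal characteristic polynomials (characteristic zero).**  Two matrix
representations `r, r' : G → GL_n(K)` of a monoid over a domain of characteristic `0` with
`tr r'(g) = tr r(g)` for all `g` have `det(X - r'(g)) = det(X - r(g))` for all `g`: the power traces
`tr(r(g)^{j+1}) = tr r(g^{j+1})` agree, and Newton's identities apply
(`charpoly_eq_of_trace_pow_eq`). [folklore] -/
theorem charpoly_eq_of_trace_eq {G : Type*} [Monoid G] {K : Type*} [CommRing K] [IsDomain K]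
    [CharZero K] {n : ℕ} (r r' : G →* GL (Fin n) K)
    (h : ∀ g, ((r' g : GL (Fin n) K) : Matrix (Fin n) (Fin n) K).trace =
      ((r g : GL (Fin n) K) : Matrix (Fin n) (Fin n) K).trace) (g : G) :
    ((r' g : GL (Fin n) K) : Matrix (Fin n) (Fin n) K).charpoly =
      ((r g : GL (Fin n) K) : Matrix (Fin n) (Fin n) K).charpoly := by
  refine charpoly_eq_of_trace_pow_eq fun j => ?_
  rw [← Units.val_pow_eq_pow_val, ← Units.val_pow_eq_pow_val, ← map_pow, ← map_pow, h]

end Newton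

/-! ### Newton's identities with a `p`-adic loss: ultrametric normed fields -/

section Ultrametric

variable {K : Type*} [NormedField K] [IsUltrametricDist K] [CharZero K]
  {ι : Type*} [Fintype ι] [DecidableEq ι]

/-- `‖(a ! : K)‖⁻¹ ≤ ‖(m ! : K)‖⁻¹` for `a ≤ m` in an ultrametric normed field of characteristic
zero (`m! = a! · (m!/a!)` and natural numbers have norm `≤ 1`). [folklore] -/
theorem inv_norm_factorial_mono {a m : ℕ} (ham : a ≤ m) :
    ‖((a.factorial : ℕ) : K)‖⁻¹ ≤ ‖((m.factorial : ℕ) : K)‖⁻¹ := by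
  have ha : 0 < ‖((a.factorial : ℕ) : K)‖ :=
    norm_pos_iff.mpr (by exact_mod_cast (Nat.factorial_pos a).ne')
  have hm : 0 < ‖((m.factorial : ℕ) : K)‖ :=
    norm_pos_iff.mpr (by exact_mod_cast (Nat.factorial_pos m).ne')
  rw [inv_le_inv₀ ha hm]
  obtain ⟨c, hc⟩ := Nat.factorial_dvd_factorial ham
  rw [hc, Nat.cast_mul, norm_mul]
  exact mul_le_of_le_one_right (norm_nonneg _) (IsUltrametricDist.norm_natCast_le_one K c)

/-- `1 ≤ ‖(m ! : K)‖⁻¹`. [folklore] -/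
theorem one_le_inv_norm_factorial (m : ℕ) : (1 : ℝ) ≤ ‖((m.factorial : ℕ) : K)‖⁻¹ := by
  have hm : 0 < ‖((m.factorial : ℕ) : K)‖ :=
    norm_pos_iff.mpr (by exact_mod_cast (Nat.factorial_pos m).ne')
  rw [le_inv_comm₀ one_pos hm, inv_one]
  exact IsUltrametricDist.norm_natCast_le_one K _

/-- **Newton's identities with `p`-adic loss (reversed characteristic polynomial).**  In an
ultrametric normed field of characteristic zero, let `A`, `B` be square matrices of the same size
with INTEGRAL data (`‖c_a(A)‖ ≤ 1` for the coefficients of `det(1 - X·A)`, `‖tr(B^{j+1})‖ ≤ 1`)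
whose power traces are `ε`-close: `‖tr(A^{j+1}) - tr(B^{j+1})‖ ≤ ε` for all `j`.  Then
`‖c_m(A) - c_m(B)‖ ≤ ‖m!‖⁻¹ · ε`: induction on `m` in `(m+1) c_{m+1} = -∑_{a+b=m} c_a tr(·^{b+1})`,
writing `c_a(A) t_b(A) - c_a(B) t_b(B) = c_a(A) (t_b(A) - t_b(B)) + (c_a(A) - c_a(B)) t_b(B)`.
[folklore] -/
theorem norm_coeff_charpolyRev_sub_le {A B : Matrix ι ι K} {ε : ℝ}
    (hA : ∀ m, ‖A.charpolyRev.coeff m‖ ≤ 1) (hB : ∀ j, ‖(B ^ (j + 1)).trace‖ ≤ 1)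
    (h : ∀ j, ‖(A ^ (j + 1)).trace - (B ^ (j + 1)).trace‖ ≤ ε) (m : ℕ) :
    ‖A.charpolyRev.coeff m - B.charpolyRev.coeff m‖ ≤ ‖((m.factorial : ℕ) : K)‖⁻¹ * ε := by
  have hε : 0 ≤ ε := (norm_nonneg _).trans (h 0)
  induction m using Nat.strong_induction_on with
  | _ m ih =>
    cases m with
    | zero =>
      rw [Polynomial.coeff_zero_eq_eval_zero, Polynomial.coeff_zero_eq_eval_zero,
        Matrix.eval_charpolyRev, Matrix.eval_charpolyRev, sub_self, norm_zero]
      exact mul_nonneg (inv_nonneg.mpr (norm_nonneg _)) hε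
    | succ m =>
      have hm1 : ((m : K) + 1) ≠ 0 := by exact_mod_cast Nat.succ_ne_zero m
      have hm1' : 0 < ‖((m : K) + 1)‖ := norm_pos_iff.mpr hm1
      -- the difference of the two Newton identities
      have key : (A.charpolyRev.coeff (m + 1) - B.charpolyRev.coeff (m + 1)) * ((m : K) + 1) =
          -∑ x ∈ antidiagonal m, (A.charpolyRev.coeff x.1 * ((A ^ (x.2 + 1)).trace -
              (B ^ (x.2 + 1)).trace) +
            (A.charpolyRev.coeff x.1 - B.charpolyRev.coeff x.1) * (B ^ (x.2 + 1)).trace) := by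
        rw [sub_mul, coeff_charpolyRev_succ_mul, coeff_charpolyRev_succ_mul, neg_sub_neg,
          ← Finset.sum_sub_distrib, ← Finset.sum_neg_distrib]
        exact Finset.sum_congr rfl fun x _ => by ring
      have hsum : ‖∑ x ∈ antidiagonal m, (A.charpolyRev.coeff x.1 * ((A ^ (x.2 + 1)).trace -
              (B ^ (x.2 + 1)).trace) +
            (A.charpolyRev.coeff x.1 - B.charpolyRev.coeff x.1) * (B ^ (x.2 + 1)).trace)‖ ≤
          ‖((m.factorial : ℕ) : K)‖⁻¹ * ε := by
        refine IsUltrametricDist.norm_sum_le_of_forall_le_of_nonneg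
          (mul_nonneg (inv_nonneg.mpr (norm_nonneg _)) hε) fun x hx => ?_
        have hx1 : x.1 ≤ m := by have := mem_antidiagonal.mp hx; omega
        refine (IsUltrametricDist.norm_add_le_max _ _).trans (max_le ?_ ?_)
        · rw [norm_mul]
          calc ‖A.charpolyRev.coeff x.1‖ * ‖(A ^ (x.2 + 1)).trace - (B ^ (x.2 + 1)).trace‖
              ≤ 1 * ε := mul_le_mul (hA _) (h _) (norm_nonneg _) zero_le_one
            _ ≤ ‖((m.factorial : ℕ) : K)‖⁻¹ * ε :=
                mul_le_mul_of_nonneg_right (one_le_inv_norm_factorial m) hε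
        · rw [norm_mul]
          calc ‖A.charpolyRev.coeff x.1 - B.charpolyRev.coeff x.1‖ * ‖(B ^ (x.2 + 1)).trace‖
              ≤ ‖((x.1.factorial : ℕ) : K)‖⁻¹ * ε * 1 :=
                mul_le_mul (ih x.1 (by omega)) (hB _) (norm_nonneg _)
                  (mul_nonneg (inv_nonneg.mpr (norm_nonneg _)) hε)
            _ ≤ ‖((m.factorial : ℕ) : K)‖⁻¹ * ε := by
                rw [mul_one]
                exact mul_le_mul_of_nonneg_right (inv_norm_factorial_mono hx1) hε
      have hnorm : ‖A.charpolyRev.coeff (m + 1) - B.charpolyRev.coeff (m + 1)‖ =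
          ‖((m : K) + 1)‖⁻¹ * ‖(A.charpolyRev.coeff (m + 1) - B.charpolyRev.coeff (m + 1)) *
            ((m : K) + 1)‖ := by
        rw [norm_mul, mul_comm ‖((m : K) + 1)‖⁻¹, mul_assoc, mul_inv_cancel₀ hm1'.ne', mul_one]
      rw [hnorm, key, norm_neg, Nat.factorial_succ, Nat.cast_mul, Nat.cast_succ, norm_mul, mul_inv,
        mul_assoc]
      exact mul_le_mul_of_nonneg_left hsum (inv_nonneg.mpr (norm_nonneg _))

omit [IsUltrametricDist K] [CharZero K] in
/-- The coefficients of `det(1 - X·A)` are those of `det(X - A)` read backwards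
(`Matrix.reverse_charpoly`), so a uniform bound on the latter bounds the former. [folklore] -/
theorem norm_coeff_charpolyRev_le_of_charpoly {A : Matrix ι ι K} {C : ℝ}
    (hA : ∀ k, ‖A.charpoly.coeff k‖ ≤ C) (m : ℕ) : ‖A.charpolyRev.coeff m‖ ≤ C := by
  rw [← Matrix.reverse_charpoly, Polynomial.coeff_reverse]
  exact hA _

/-- **Newton's identities with `p`-adic loss (characteristic polynomial).**  Same hypotheses as
`norm_coeff_charpolyRev_sub_le`, with integrality of the coefficients of `det(X - A)`: every
coefficient of `det(X - A) - det(X - B)` has norm `≤ ‖n!‖⁻¹ · ε`, `n` the size. [folklore] -/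
theorem norm_coeff_charpoly_sub_le {A B : Matrix ι ι K} {ε : ℝ}
    (hA : ∀ k, ‖A.charpoly.coeff k‖ ≤ 1) (hB : ∀ j, ‖(B ^ (j + 1)).trace‖ ≤ 1)
    (h : ∀ j, ‖(A ^ (j + 1)).trace - (B ^ (j + 1)).trace‖ ≤ ε) (k : ℕ) :
    ‖A.charpoly.coeff k - B.charpoly.coeff k‖ ≤
      ‖(((Fintype.card ι).factorial : ℕ) : K)‖⁻¹ * ε := by
  have hε : 0 ≤ ε := (norm_nonneg _).trans (h 0)
  by_cases hk : k ≤ Fintype.card ι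
  · have hA' := Polynomial.coeff_reverse A.charpoly (Fintype.card ι - k)
    have hB' := Polynomial.coeff_reverse B.charpoly (Fintype.card ι - k)
    rw [Matrix.reverse_charpoly, Matrix.charpoly_natDegree_eq_dim,
      Polynomial.revAt_le (Nat.sub_le _ _), Nat.sub_sub_self hk] at hA' hB'
    rw [← hA', ← hB']
    exact (norm_coeff_charpolyRev_sub_le (norm_coeff_charpolyRev_le_of_charpoly hA) hB h _).trans
      (mul_le_mul_of_nonneg_right (inv_norm_factorial_mono (Nat.sub_le _ _)) hε)
  · rw [Polynomial.coeff_eq_zero_of_natDegree_lt (by rw [Matrix.charpoly_natDegree_eq_dim]; omega),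
      Polynomial.coeff_eq_zero_of_natDegree_lt (by rw [Matrix.charpoly_natDegree_eq_dim]; omega),
      sub_self, norm_zero]
    exact mul_nonneg (inv_nonneg.mpr (norm_nonneg _)) hε

end Ultrametric

/-! ### Over `ℚ̄_p`: integrality, `p`-adic closeness of characteristic polynomials, endoscopy -/

section Padic

open Literature.NumberTheory.GaloisRepresentations

variable {p : ℕ} [Fact p.Prime]
variable {G : Type*} [Group G] [TopologicalSpace G] [CompactSpace G] {n : ℕ}

/-- **Integrality of characteristic polynomials**: for a continuous representation `r : G → GL_n(ℚ̄_p)`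
of a compact group, every coefficient of `det(X - r(g))` has norm `≤ 1`
(tree `FramedRep.charpoly_coeff_mem_integer`). [folklore] -/
theorem norm_charpoly_coeff_le_one (r : FramedRep G (PadicAlgCl p) n) (g : G) (k : ℕ) :
    ‖((r g : GL (Fin n) (PadicAlgCl p)) : Matrix (Fin n) (Fin n) (PadicAlgCl p)).charpoly.coeff k‖
      ≤ 1 := by
  have h : Valued.v (((r g : GL (Fin n) (PadicAlgCl p)) :
      Matrix (Fin n) (Fin n) (PadicAlgCl p)).charpoly.coeff k) ≤ 1 :=
    FramedRep.charpoly_coeff_mem_integer r g k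
  rw [PadicAlgCl.valuation_def] at h
  exact_mod_cast h

/-- **Integrality of traces**: `‖tr r(g)‖ ≤ 1` for a continuous representation
`r : G → GL_n(ℚ̄_p)` of a compact group (`tr = -` the `X^{n-1}`-coefficient of `det(X - r(g))`).
[folklore] -/
theorem norm_trace_le_one (r : FramedRep G (PadicAlgCl p) n) (g : G) :
    ‖((r g : GL (Fin n) (PadicAlgCl p)) : Matrix (Fin n) (Fin n) (PadicAlgCl p)).trace‖ ≤ 1 := by
  cases n with
  | zero => rw [Matrix.trace_fin_zero, norm_zero]; exact zero_le_one
  | succ n =>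
    rw [Matrix.trace_eq_neg_charpoly_coeff, norm_neg]
    exact norm_charpoly_coeff_le_one r g _

/-- **Uniformly close traces give `p`-adically close characteristic polynomials** (Newton's
identities with `p`-adic loss): for continuous `r, r' : G → GL_n(ℚ̄_p)` on a compact group with
`‖tr r'(g) - tr r(g)‖ ≤ ε` for ALL `g`, every coefficient of `det(X - r'(g)) - det(X - r(g))` has norm
`≤ ‖n!‖_p⁻¹ · ε` (no loss when `p > n`).  The power traces `tr(r(g)^{j+1}) = tr r(g^{j+1})` are
`ε`-close and integral. [folklore] -/
theorem norm_charpoly_coeff_sub_le_of_trace (r r' : FramedRep G (PadicAlgCl p) n) {ε : ℝ}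
    (h : ∀ g, ‖((r' g : GL (Fin n) (PadicAlgCl p)) : Matrix (Fin n) (Fin n) (PadicAlgCl p)).trace -
      ((r g : GL (Fin n) (PadicAlgCl p)) : Matrix (Fin n) (Fin n) (PadicAlgCl p)).trace‖ ≤ ε)
    (g : G) (k : ℕ) :
    ‖((r' g : GL (Fin n) (PadicAlgCl p)) : Matrix (Fin n) (Fin n) (PadicAlgCl p)).charpoly.coeff k -
      ((r g : GL (Fin n) (PadicAlgCl p)) : Matrix (Fin n) (Fin n) (PadicAlgCl p)).charpoly.coeff k‖
      ≤ ‖((n.factorial : ℕ) : PadicAlgCl p)‖⁻¹ * ε := by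
  have hpow : ∀ (s : FramedRep G (PadicAlgCl p) n) (j : ℕ),
      ((s g : GL (Fin n) (PadicAlgCl p)) : Matrix (Fin n) (Fin n) (PadicAlgCl p)) ^ (j + 1) =
        ((s (g ^ (j + 1)) : GL (Fin n) (PadicAlgCl p)) : Matrix (Fin n) (Fin n) (PadicAlgCl p)) :=
    fun s j => by rw [map_pow, Units.val_pow_eq_pow_val]
  have key := norm_coeff_charpoly_sub_le (norm_charpoly_coeff_le_one r' g)
    (fun j => by rw [hpow]; exact norm_trace_le_one r _)
    (fun j => by rw [hpow, hpow]; exact h _) k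
  rwa [Fintype.card_fin] at key

/-- `‖4!‖_p = 1` for `p ≠ 2, 3`: in rank `4` the `p`-adic loss of
`norm_charpoly_coeff_sub_le_of_trace` is trivial off `2, 3`. [folklore] -/
theorem norm_factorial_four_eq_one (hp2 : p ≠ 2) (hp3 : p ≠ 3) :
    ‖(((4 : ℕ).factorial : ℕ) : PadicAlgCl p)‖ = 1 := by
  rw [← map_natCast (algebraMap ℚ_[p] (PadicAlgCl p)), PadicAlgCl.norm_extends,
    Padic.norm_natCast_eq_one_iff]
  have h24 : (4 : ℕ).factorial = 2 ^ 3 * 3 := by decide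
  rw [h24]
  refine Nat.Coprime.mul_right (Nat.Coprime.pow_right _ ?_) ?_
  · exact (Nat.coprime_primes Fact.out Nat.prime_two).mpr hp2
  · exact (Nat.coprime_primes Fact.out Nat.prime_three).mpr hp3

/-- **Registered sub-goal `stub_traceLimitCharpoly` of Stub 4** (the statement through which this
helper file lands, `--supports stmt-Langlands-13639`): for continuous `r, r' : Γ_ℚ → GL_n(ℚ̄_p)` whose
traces are uniformly `ε`-close on `Γ_ℚ`, the characteristic polynomials `det(X - r'(g))`,
`det(X - r(g))` are `‖n!‖_p⁻¹ · ε`-close coefficientwise at every `g ∈ Γ_ℚ`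
(`norm_charpoly_coeff_sub_le_of_trace` for the compact group `Γ_ℚ`, tree
`absoluteGaloisGroup_compactSpace`).  Along the pro-automorphy hypothesis of
`stub_weightTwoClassicality` this is the convergence `det(X - r'_n(g)) → det(X - ρ(g))`, uniform in
`g`. [folklore] -/
theorem stub_traceLimitCharpoly :
    ∀ (p : ℕ) [Fact p.Prime] (n : ℕ)
      (r r' : Literature.NumberTheory.GaloisRepresentations.FramedGaloisRep ℚ (PadicAlgCl p) n) (ε : ℝ),
      (∀ g, ‖(r' g).val.trace - (r g).val.trace‖ ≤ ε) →
      ∀ (g : Field.absoluteGaloisGroup ℚ) (k : ℕ),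
        ‖(r' g).val.charpoly.coeff k - (r g).val.charpoly.coeff k‖ ≤
          ‖((n.factorial : ℕ) : PadicAlgCl p)‖⁻¹ * ε := by
  intro p _ n r r' ε h g k
  haveI : CompactSpace (Field.absoluteGaloisGroup ℚ) := absoluteGaloisGroup_compactSpace ℚ
  exact norm_charpoly_coeff_sub_le_of_trace r r' h g k

end Padic

end Summit.Langlands.Langlands.Cruxes.ResiduallyYoshidaLifting.EndoscopicCrossingEuler

end
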